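import Summits.ValiantsHypothesis.ValiantsHypothesis.Theorems.DefinabilityGapSparseFree
import Summits.ValiantsHypothesis.ValiantsHypothesis.Theorems.DefinabilityGapPivotFreeDict
import Summits.ValiantsHypothesis.ValiantsHypothesis.Theorems.DefinabilityGapPivotCrowded
import HarnessLib

/-!
# Definability gap, ROAD P: free cells of a crowded line (N1 v2 (c), instantiated)

The crowded-line bound on a sparse subfamily (`DefinabilityGapSparseFree.weight_fewFreeOn_le`)
read on the minors through the dictionary of `DefinabilityGapPivotFreeDict`.  For a row `i`
(column `j`) of the block of `c` let `freeCols T c r i` (`freeRows T c r j`) be the positions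
none of whose co-curves is assigned the row of that position.

* HEAVY BRANCH (deterministic): under the row rule "no curve is assigned a row containing one
  of its `N`-heavy cells", every `N`-heavy position is free (`free_of_heavy`,
  `rowHeavy_subset_freeCols`, `colHeavy_subset_freeRows`), so a line with at most `m − B`
  light positions has at least `B` free ones (`le_card_freeCols_of_heavy`,
  `le_card_freeRows_of_heavy`);
* LIGHT BRANCH (probabilistic): with `2 ≤ s ≤ #light positions`, point weights `≤ p ≤ 1/2`
  and any `σ ≥ sparseLoad`, the assignments with fewer than `B ≤ e^{−2pN} s/2 − 2(σ + t)`
  free positions weigh at most `exp(−e^{−2pN} s/8) + exp(−t²/(2(σ + t/3)))`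
  (`weight_fewFreeCols_le`, `weight_fewFreeRows_le`);
* `sparseLoad_le`: `sparseLoad p N n s ≤ 4 p N s² / n` (`2 ≤ s ≤ n`), the form used with
  `s = ρ m`, `n ≥ m/2`.
-/

namespace Summit.ValiantsHypothesis.ValiantsHypothesis.Theorems.DefinabilityGapCrowdedFree

open Finset Real Literature.Probability.Moments
open Literature.Computability.AlgebraicComplexity Literature.Computability.MetaComplexity
open Summit.ValiantsHypothesis.ValiantsHypothesis.Theorems.DefinabilityGapAffineRung
open Summit.ValiantsHypothesis.ValiantsHypothesis.Theorems.DefinabilityGapPivotCertificate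
open Summit.ValiantsHypothesis.ValiantsHypothesis.Theorems.DefinabilityGapPivotAdmissible
open Summit.ValiantsHypothesis.ValiantsHypothesis.Theorems.DefinabilityGapPivotCrowded
open Summit.ValiantsHypothesis.ValiantsHypothesis.Theorems.DefinabilityGapSparseSubfamily
open Summit.ValiantsHypothesis.ValiantsHypothesis.Theorems.DefinabilityGapPrivateFree
open Summit.ValiantsHypothesis.ValiantsHypothesis.Theorems.DefinabilityGapActiveShared
open Summit.ValiantsHypothesis.ValiantsHypothesis.Theorems.DefinabilityGapPairWeightBound
open Summit.ValiantsHypothesis.ValiantsHypothesis.Theorems.DefinabilityGapSparseFree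
open Summit.ValiantsHypothesis.ValiantsHypothesis.Theorems.DefinabilityGapPivotFreeDict

/-! ## 0. Two generic complements to `DefinabilityGapSparseFree` -/

section Generic

variable {α β Γ : Type*} [DecidableEq α] [DecidableEq β]

/-- **Closed-form bound** `sparseLoad p N n s ≤ 4 p N s² / n` for `2 ≤ s ≤ n`, from
`C(n, s) C(s, 2) = C(n, 2) C(n−2, s−2)`, `C(s, 2) ≤ s²/2` and `(n−1)²/2 ≤ C(n, 2)`. [this file] -/
theorem sparseLoad_le {p : ℝ} (hp : 0 ≤ p) (N : ℕ) {n s : ℕ} (hs : 2 ≤ s) (hsn : s ≤ n) :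
    sparseLoad p N n s ≤ 4 * p * N * (s : ℝ) ^ 2 / n := by
  have hmul : (n.choose s : ℝ) * (s.choose 2 : ℝ) =
      (n.choose 2 : ℝ) * ((n - 2).choose (s - 2) : ℝ) := by
    exact_mod_cast Nat.choose_mul (n := n) hs
  have hcs : (0 : ℝ) < (n.choose s : ℕ) := by exact_mod_cast Nat.choose_pos hsn
  have hc2 : (0 : ℝ) < (n.choose 2 : ℕ) := by exact_mod_cast Nat.choose_pos (hs.trans hsn)
  have hn : (0 : ℝ) < n := by exact_mod_cast (show 0 < n by omega)
  have hn1 : (1 : ℝ) ≤ (n : ℝ) - 1 := by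
    have : (2 : ℝ) ≤ n := by exact_mod_cast (hs.trans hsn)
    linarith
  have e : sparseLoad p N n s = p * N * n * (s.choose 2 : ℝ) / (n.choose 2 : ℝ) := by
    unfold sparseLoad
    rw [div_eq_div_iff hcs.ne' hc2.ne']
    calc p * N * n * ((n - 2).choose (s - 2) : ℝ) * (n.choose 2 : ℝ)
        = p * N * n * ((n.choose 2 : ℝ) * ((n - 2).choose (s - 2) : ℝ)) := by ring
      _ = p * N * n * ((n.choose s : ℝ) * (s.choose 2 : ℝ)) := by rw [hmul]
      _ = p * N * n * (s.choose 2 : ℝ) * (n.choose s : ℝ) := by ring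
  have hs2 : (s.choose 2 : ℝ) ≤ (s : ℝ) ^ 2 / 2 := by
    have h := Nat.choose_le_pow_div 2 s (α := ℝ)
    norm_num [Nat.factorial] at h
    exact h
  have hn2 : ((n : ℝ) - 1) ^ 2 / 2 ≤ (n.choose 2 : ℝ) := by
    have h := Nat.pow_le_choose 2 n (α := ℝ)
    have hcast : ((n + 1 - 2 : ℕ) : ℝ) = (n : ℝ) - 1 := by
      rw [show n + 1 - 2 = n - 1 by omega, Nat.cast_sub (by omega), Nat.cast_one]
    norm_num [Nat.factorial] at h
    rw [hcast] at h
    exact h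
  rw [e, div_le_div_iff₀ hc2 hn]
  -- `p N n C(s,2) · n ≤ 4 p N s² · C(n,2)`
  have h1 : p * N * n * (s.choose 2 : ℝ) * n ≤ p * N * n * ((s : ℝ) ^ 2 / 2) * n :=
    mul_le_mul_of_nonneg_right (mul_le_mul_of_nonneg_left hs2 (by positivity)) hn.le
  have h2 : p * N * n * ((s : ℝ) ^ 2 / 2) * n ≤
      4 * p * N * (s : ℝ) ^ 2 * (((n : ℝ) - 1) ^ 2 / 2) := by
    -- `n² / 2 ≤ 2 (n − 1)²` for `n ≥ 2`
    have h3 : (n : ℝ) * n ≤ 4 * ((n : ℝ) - 1) ^ 2 := by nlinarith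
    have h4 : 0 ≤ p * N * (s : ℝ) ^ 2 := by positivity
    nlinarith
  have h5 : 4 * p * N * (s : ℝ) ^ 2 * (((n : ℝ) - 1) ^ 2 / 2) ≤
      4 * p * N * (s : ℝ) ^ 2 * (n.choose 2 : ℝ) :=
    mul_le_mul_of_nonneg_left hn2 (by positivity)
  linarith

open scoped Classical in
/-- `weight_fewFreeOn_le` with any `σ ≥ sparseLoad` in place of `sparseLoad`. [this file] -/
theorem weight_fewFreeOn_le_of_le [Fintype β] [Fintype Γ] [DecidableEq Γ] {w : β → Γ → ℝ}
    (hw : ∀ b a, 0 ≤ w b a) (hw1 : ∀ b, ∑ a, w b a = 1) {p : ℝ} (hp0 : 0 < p)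
    (hp : p ≤ 1 / 2) (hwp : ∀ b a, w b a ≤ p) (K : α → Finset β) (τ : α → Γ) (L : Finset α)
    (htwo : ∀ b, (L.filter fun j => b ∈ K j).card ≤ 2) {N : ℕ} (hN : 0 < N)
    (hK : ∀ j ∈ L, (K j).card ≤ N) {s : ℕ} (hs : 2 ≤ s) (hsL : s ≤ L.card) {t σ : ℝ}
    (ht : 0 < t) (hσ : sparseLoad p N L.card s ≤ σ) {B : ℝ}
    (hB : B ≤ exp (-(2 * p * N)) * s / 2 - 2 * (σ + t)) :
    ∑ r ∈ (Finset.univ : Finset (β → Γ)).filter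
        (fun r => ((L.filter (free K (fun j b => r b = τ j))).card : ℝ) < B), prodWeight w r
      ≤ exp (-(exp (-(2 * p * N)) * s / 8)) + exp (-(t ^ 2 / (2 * (σ + 1 * t / 3)))) := by
  have hApos : 0 < sparseLoad p N L.card s := sparseLoad_pos hp0 hN hs hsL
  have h := weight_fewFreeOn_le hw hw1 hp0 hp hwp K τ L htwo hN hK hs hsL ht
    (B := B) (by linarith)
  refine h.trans ?_
  gcongr

end Generic

/-! ## 1. Free positions of a line -/

variable {m : ℕ}

/-- FREE COLUMNS of row `i` of the block of `c`: no co-curve through `(i, j)` is assigned row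
`i`. [this file] -/
noncomputable def freeCols (T : Finset (Fin 3 → Fin (qOf m))) (c : Fin 3 → Fin (qOf m))
    (r : (Fin 3 → Fin (qOf m)) → Fin m) (i : Fin m) : Finset (Fin m) :=
  univ.filter fun j => ∀ c' ∈ coCurves T c (i, j), r c' ≠ i

/-- FREE ROWS of column `j` of the block of `c`: no co-curve through `(a, j)` is assigned row
`a`. [this file] -/
noncomputable def freeRows (T : Finset (Fin 3 → Fin (qOf m))) (c : Fin 3 → Fin (qOf m))
    (r : (Fin 3 → Fin (qOf m)) → Fin m) (j : Fin m) : Finset (Fin m) :=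
  univ.filter fun a => ∀ c' ∈ coCurves T c (a, j), r c' ≠ a

/-- Membership in `freeCols`. [this file] -/
theorem mem_freeCols {T : Finset (Fin 3 → Fin (qOf m))} {c : Fin 3 → Fin (qOf m)}
    {r : (Fin 3 → Fin (qOf m)) → Fin m} {i j : Fin m} :
    j ∈ freeCols T c r i ↔ ∀ c' ∈ coCurves T c (i, j), r c' ≠ i := by
  simp [freeCols]

/-- Membership in `freeRows`. [this file] -/
theorem mem_freeRows {T : Finset (Fin 3 → Fin (qOf m))} {c : Fin 3 → Fin (qOf m)}
    {r : (Fin 3 → Fin (qOf m)) → Fin m} {a j : Fin m} :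
    a ∈ freeRows T c r j ↔ ∀ c' ∈ coCurves T c (a, j), r c' ≠ a := by
  simp [freeRows]

/-! ## 2. Heavy branch: heavy positions are free under the row rule -/

/-- Under the row rule for threshold `N`, an `N`-heavy cell `(a, j)` of `c ∈ T` is free: a
co-curve `c'` through it has the same cell as an `N`-heavy cell in row `a`, so `r c' ≠ a`.
[this file] -/
theorem free_of_heavy {T : Finset (Fin 3 → Fin (qOf m))} {r : (Fin 3 → Fin (qOf m)) → Fin m}
    {N : ℕ} (hrule : ∀ c' ∈ T, r c' ∉ heavyRows T c' N) {c : Fin 3 → Fin (qOf m)} (hc : c ∈ T)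
    {a j : Fin m} (hheavy : N ≤ (coCurves T c (a, j)).card) :
    ∀ c' ∈ coCurves T c (a, j), r c' ≠ a := by
  intro c' hc' hrc'
  have hc'T : c' ∈ T := (mem_coCurves.mp hc').1
  refine hrule c' hc'T ?_
  rw [hrc']
  exact mem_heavyRows.mpr ⟨j, by rw [card_coCurves_eq_of_mem hc hc']; exact hheavy⟩

/-- Heavy positions of a row are free columns (row rule, `c ∈ T`). [this file] -/
theorem rowHeavy_subset_freeCols {T : Finset (Fin 3 → Fin (qOf m))}
    {r : (Fin 3 → Fin (qOf m)) → Fin m} {N : ℕ} (hrule : ∀ c' ∈ T, r c' ∉ heavyRows T c' N)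
    {c : Fin 3 → Fin (qOf m)} (hc : c ∈ T) (i : Fin m) :
    rowHeavy T c N i ⊆ freeCols T c r i := fun _ hj =>
  mem_freeCols.mpr (free_of_heavy hrule hc (mem_rowHeavy.mp hj))

/-- Heavy positions of a column are free rows (row rule, `c ∈ T`). [this file] -/
theorem colHeavy_subset_freeRows {T : Finset (Fin 3 → Fin (qOf m))}
    {r : (Fin 3 → Fin (qOf m)) → Fin m} {N : ℕ} (hrule : ∀ c' ∈ T, r c' ∉ heavyRows T c' N)
    {c : Fin 3 → Fin (qOf m)} (hc : c ∈ T) (j : Fin m) :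
    colHeavy T c N j ⊆ freeRows T c r j := fun _ ha =>
  mem_freeRows.mpr (free_of_heavy hrule hc (mem_colHeavy.mp ha))

/-- `#rowHeavy + #lightCols = m`. [this file] -/
theorem card_rowHeavy_add_card_lightCols (T : Finset (Fin 3 → Fin (qOf m)))
    (c : Fin 3 → Fin (qOf m)) (N : ℕ) (i : Fin m) :
    (rowHeavy T c N i).card + (lightCols T c N i).card = m := by
  have h := Finset.card_filter_add_card_filter_not
    (s := (Finset.univ : Finset (Fin m))) (fun j => N ≤ (coCurves T c (i, j)).card)
  simp only [not_le, Finset.card_univ, Fintype.card_fin] at h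
  exact h

/-- `#colHeavy + #lightRows = m`. [this file] -/
theorem card_colHeavy_add_card_lightRows (T : Finset (Fin 3 → Fin (qOf m)))
    (c : Fin 3 → Fin (qOf m)) (N : ℕ) (j : Fin m) :
    (colHeavy T c N j).card + (lightRows T c N j).card = m := by
  have h := Finset.card_filter_add_card_filter_not
    (s := (Finset.univ : Finset (Fin m))) (fun a => N ≤ (coCurves T c (a, j)).card)
  simp only [not_le, Finset.card_univ, Fintype.card_fin] at h
  exact h

/-- **Heavy branch, rows**: `#lightCols + B ≤ m` ⟹ `B ≤ #freeCols` (row rule, `c ∈ T`).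
[this file] -/
theorem le_card_freeCols_of_heavy {T : Finset (Fin 3 → Fin (qOf m))}
    {r : (Fin 3 → Fin (qOf m)) → Fin m} {N : ℕ} (hrule : ∀ c' ∈ T, r c' ∉ heavyRows T c' N)
    {c : Fin 3 → Fin (qOf m)} (hc : c ∈ T) (i : Fin m) {B : ℕ}
    (hL : (lightCols T c N i).card + B ≤ m) : B ≤ (freeCols T c r i).card := by
  have h1 := card_rowHeavy_add_card_lightCols T c N i
  have h2 := Finset.card_le_card (rowHeavy_subset_freeCols hrule hc i (r := r))
  omega

/-- **Heavy branch, columns**: `#lightRows + B ≤ m` ⟹ `B ≤ #freeRows`. [this file] -/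
theorem le_card_freeRows_of_heavy {T : Finset (Fin 3 → Fin (qOf m))}
    {r : (Fin 3 → Fin (qOf m)) → Fin m} {N : ℕ} (hrule : ∀ c' ∈ T, r c' ∉ heavyRows T c' N)
    {c : Fin 3 → Fin (qOf m)} (hc : c ∈ T) (j : Fin m) {B : ℕ}
    (hL : (lightRows T c N j).card + B ≤ m) : B ≤ (freeRows T c r j).card := by
  have h1 := card_colHeavy_add_card_lightRows T c N j
  have h2 := Finset.card_le_card (colHeavy_subset_freeRows hrule hc j (r := r))
  omega

/-! ## 3. Light branch: the sparse-subfamily bound on the minors -/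

/-- Free light positions (abstract `free`, row dictionary) are free columns. [this file] -/
theorem filter_free_subset_freeCols (T : Finset (Fin 3 → Fin (qOf m)))
    (c : Fin 3 → Fin (qOf m)) (r : (Fin 3 → Fin (qOf m)) → Fin m) (i : Fin m)
    (L : Finset (Fin m))
    [DecidablePred (free (fun j => coCurves T c (i, j)) (fun _ c' => r c' = i))] :
    L.filter (free (fun j => coCurves T c (i, j)) (fun _ c' => r c' = i)) ⊆ freeCols T c r i :=
  fun _ hj => mem_freeCols.mpr (Finset.mem_filter.mp hj).2

/-- Free light positions (abstract `free`, column dictionary) are free rows. [this file] -/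
theorem filter_free_subset_freeRows (T : Finset (Fin 3 → Fin (qOf m)))
    (c : Fin 3 → Fin (qOf m)) (r : (Fin 3 → Fin (qOf m)) → Fin m) (j : Fin m)
    (R : Finset (Fin m))
    [DecidablePred (free (fun a => coCurves T c (a, j)) (fun a c' => r c' = a))] :
    R.filter (free (fun a => coCurves T c (a, j)) (fun a c' => r c' = a)) ⊆ freeRows T c r j :=
  fun _ ha => mem_freeRows.mpr (Finset.mem_filter.mp ha).2

open scoped Classical in
/-- **Light branch, rows.**  Point weights `≤ p ≤ 1/2`, `2 ≤ s ≤ #lightCols T c N i`,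
`σ ≥ sparseLoad p N #lightCols s`, `B ≤ e^{−2pN} s/2 − 2(σ + t)`: the assignments with fewer
than `B` free columns in row `i` of the block of `c` weigh at most
`exp(−e^{−2pN} s/8) + exp(−t²/(2(σ + t/3)))`. [this file] -/
theorem weight_fewFreeCols_le {w : (Fin 3 → Fin (qOf m)) → Fin m → ℝ}
    (hw : ∀ b a, 0 ≤ w b a) (hw1 : ∀ b, ∑ a, w b a = 1) {p : ℝ} (hp0 : 0 < p)
    (hp : p ≤ 1 / 2) (hwp : ∀ b a, w b a ≤ p) (T : Finset (Fin 3 → Fin (qOf m)))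
    (c : Fin 3 → Fin (qOf m)) (i : Fin m) {N : ℕ} (hN : 0 < N) {s : ℕ} (hs : 2 ≤ s)
    (hsL : s ≤ (lightCols T c N i).card) {t σ : ℝ} (ht : 0 < t)
    (hσ : sparseLoad p N (lightCols T c N i).card s ≤ σ) {B : ℝ}
    (hB : B ≤ exp (-(2 * p * N)) * s / 2 - 2 * (σ + t)) :
    ∑ r ∈ (Finset.univ : Finset ((Fin 3 → Fin (qOf m)) → Fin m)).filter
        (fun r => ((freeCols T c r i).card : ℝ) < B), prodWeight w r
      ≤ exp (-(exp (-(2 * p * N)) * s / 8)) + exp (-(t ^ 2 / (2 * (σ + 1 * t / 3)))) := by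
  have h := weight_fewFreeOn_le_of_le hw hw1 hp0 hp hwp (fun j => coCurves T c (i, j))
    (fun _ => i) (lightCols T c N i) (card_filter_mem_coCurves_row_le_two T c · i _) hN
    (fun j hj => (mem_lightCols.mp hj).le) hs hsL ht hσ hB
  refine le_trans (Finset.sum_le_sum_of_subset_of_nonneg ?_ fun r _ _ => prodWeight_nonneg hw r) h
  intro r hr
  rw [Finset.mem_filter] at hr ⊢
  refine ⟨Finset.mem_univ _, lt_of_le_of_lt ?_ hr.2⟩
  exact_mod_cast Finset.card_le_card (filter_free_subset_freeCols T c r i (lightCols T c N i))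

open scoped Classical in
/-- **Light branch, columns.**  The same for the free rows of column `j` of the block of `c`
(`2 ≤ s ≤ #lightRows T c N j`). [this file] -/
theorem weight_fewFreeRows_le {w : (Fin 3 → Fin (qOf m)) → Fin m → ℝ}
    (hw : ∀ b a, 0 ≤ w b a) (hw1 : ∀ b, ∑ a, w b a = 1) {p : ℝ} (hp0 : 0 < p)
    (hp : p ≤ 1 / 2) (hwp : ∀ b a, w b a ≤ p) (T : Finset (Fin 3 → Fin (qOf m)))
    (c : Fin 3 → Fin (qOf m)) (j : Fin m) {N : ℕ} (hN : 0 < N) {s : ℕ} (hs : 2 ≤ s)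
    (hsL : s ≤ (lightRows T c N j).card) {t σ : ℝ} (ht : 0 < t)
    (hσ : sparseLoad p N (lightRows T c N j).card s ≤ σ) {B : ℝ}
    (hB : B ≤ exp (-(2 * p * N)) * s / 2 - 2 * (σ + t)) :
    ∑ r ∈ (Finset.univ : Finset ((Fin 3 → Fin (qOf m)) → Fin m)).filter
        (fun r => ((freeRows T c r j).card : ℝ) < B), prodWeight w r
      ≤ exp (-(exp (-(2 * p * N)) * s / 8)) + exp (-(t ^ 2 / (2 * (σ + 1 * t / 3)))) := by
  have h := weight_fewFreeOn_le_of_le hw hw1 hp0 hp hwp (fun a => coCurves T c (a, j))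
    (fun a => a) (lightRows T c N j) (card_filter_mem_coCurves_col_le_two T c · j _) hN
    (fun a ha => (mem_lightRows.mp ha).le) hs hsL ht hσ hB
  refine le_trans (Finset.sum_le_sum_of_subset_of_nonneg ?_ fun r _ _ => prodWeight_nonneg hw r) h
  intro r hr
  rw [Finset.mem_filter] at hr ⊢
  refine ⟨Finset.mem_univ _, lt_of_le_of_lt ?_ hr.2⟩
  exact_mod_cast Finset.card_le_card (filter_free_subset_freeRows T c r j (lightRows T c N j))

end Summit.ValiantsHypothesis.ValiantsHypothesis.Theorems.DefinabilityGapCrowdedFree
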